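import Literature.NumberTheory.GaloisRepresentations.ContinuousShapiroLiftCores
import Literature.NumberTheory.GaloisRepresentations.ContinuousShapiroLiftPairing
import Literature.NumberTheory.GaloisRepresentations.ContinuousCupProductConj
import HarnessLib

/-!
# Shapiro lifts under restriction along a homomorphism `θ : D → G` — the trivial double coset:
# `θ^* Sh_N^G a ↦ Sh_{θ⁻¹N}^D (θ_N^* a)` through `Maps(G ⧸ N, X)|_θ → Maps(D ⧸ θ⁻¹N, X|_θ)`, and the summed pairings
# when `θ(D)·N = G` (one double coset) — companion of `ContinuousShapiroLift.lean`

Generic continuous group cohomology (no number theory); namespace `Literature.NumberTheory.GaloisRepresentations`.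
Definitions with bodies (the comparison maps) and theorems; NO named fact, no `sorry`, no instance, no notation.

Let `θ : D →ₜ* G` be a continuous homomorphism, `N ≤ G` an open subgroup, `N_D := θ⁻¹(N) = N.comap θ ≤ D`, `X : TopRep R G`.
The map of coset spaces `ē : D ⧸ N_D → G ⧸ N`, `d N_D ↦ θ(d) N` (`quotientMapOfHom`) is injective and `θ`-equivariant; it is
surjective iff `θ(D)·N = G` (ONE double coset `θ(D) \ G / N` — e.g. `θ = (Γ_{ℚ₂} → Γ_ℚ)`, `N = Gal(ℚ̄/ℚ_n)` a layer of the cyclotomic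
`ℤ₂`-extension, where `2` is totally ramified). Pre-composition with `ē` is a morphism of `D`-representations
`Φ : Maps(G ⧸ N, X)|_θ ⟶ Maps(D ⧸ N_D, X|_θ)` (`resCoindFinHom`) — the projection onto the summand of the trivial double coset in
Mackey's decomposition (Brown III (5.6)(b); Neukirch–Schmidt–Wingberg I (1.5.6)). This file proves:

* `map_resCoindFinHom_shapiroLift` — **`H¹(θ, Φ)(Sh_N^G a) = Sh_{N_D}^D(θ_N^* a)`** on classes, for ANY systems of representatives
  (`shapiroLift`), `θ_N : N_D → N` the restriction of `θ` (`comapSubtypeHom`): on cocycles it is an identity for global representatives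
  ADAPTED to the local ones along `ē` (`shapiroCocycle` computed with the same Schreier elements), and `shapiroLift` does not depend
  on the representatives (`shapiroLift_eq_of_reps`);
* `coindFin_toLin_resCoindFinHom` — when `ē` is surjective, the summed pairing `Σ_{G/N}` restricted along `θ` IS the summed pairing
  `Σ_{D/N_D}` of the restricted pairing, through `Φ × Φ` (reindexing by the bijection `ē`);
* `map_cupProduct_coindFin_shapiroLift` — hence, when `θ(D)·N = G`:
  `θ^*(Sh_N^G a ∪_{Σ P} Sh_N^G b) = Sh_{N_D}^D(θ_N^* a) ∪_{Σ P|_θ} Sh_{N_D}^D(θ_N^* b)` in `H²(D, Z|_θ)` (`ContPairing.cupProduct_mapPair`).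

Consumer: Poitou–Tate along the layers `ℚ_n` of the cyclotomic `ℤ₂`-tower in the Shapiro model (crux K3
`SignedKatoDivisibilityUpToAtTwo` of `Summits/BirchSwinnertonDyer`, (PT-orth)): the `2`-adic local term of the global class
`Sh a ∪_Σ Sh b ∈ H²(Γ_ℚ, μ_{2^K})` is the LOCAL layer pairing of `…LayerPairingModDefs` (`Sh_n(loc_n x) ∪_{Σe} Sh_n(κ Q)` over `Γ_{ℚ₂}`).

## References
* K. S. Brown, *Cohomology of Groups* (1982), III §5 (5.6)(b) (restriction of induced modules, double cosets). [Brown1982]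
* J. Neukirch, A. Schmidt, K. Wingberg, *Cohomology of Number Fields*, 2nd ed. (2008), I §5 (1.5.6)–(1.5.7), Prop. (1.5.3)(iv),
  I §6 Prop. (1.6.4). [NeukirchSchmidtWingberg2008]
* J.-P. Serre, *Local Fields* (1979), VII §5–§6. [SerreLocalFields1979]
-/

noncomputable section

open CategoryTheory

open scoped Classical

universe u v

namespace Literature.NumberTheory.GaloisRepresentations

open _root_.TopRep
open Literature.NumberTheory.EllipticCurves (schreierElt schreierElt_mem schreierElt_coe rep_mul_schreierElt)

variable {R : Type u} [CommRing R] [TopologicalSpace R]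
variable {G : Type v} [Group G] [TopologicalSpace G]
variable {D : Type v} [Group D] [TopologicalSpace D]

/-! ## §1 The map of coset spaces `ē : D ⧸ θ⁻¹N → G ⧸ N` and the restricted homomorphism `θ_N : θ⁻¹N → N` -/

section Cosets

variable (N : Subgroup G) (θ : D →ₜ* G)

/-- **The map of coset spaces `ē : D ⧸ θ⁻¹N → G ⧸ N`, `d·θ⁻¹N ↦ θ(d)·N`** (well defined: `a⁻¹b ∈ θ⁻¹N ⇒ θ(a)⁻¹θ(b) ∈ N`).
[cite: Brown1982, III §5 (5.6)(b)] -/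
def quotientMapOfHom : D ⧸ N.comap (θ : D →* G) → G ⧸ N :=
  Quotient.map' (fun d : D => θ d) fun a b h => by
    rw [QuotientGroup.leftRel_apply] at h ⊢
    rw [Subgroup.mem_comap] at h
    simpa using h

/-- `ē (d·θ⁻¹N) = θ(d)·N`. [cite: Brown1982, III §5 (5.6)(b)] -/
@[simp]
theorem quotientMapOfHom_mk (d : D) :
    quotientMapOfHom N θ (d : D ⧸ N.comap (θ : D →* G)) = ((θ d : G) : G ⧸ N) :=
  rfl

/-- `ē` is `θ`-equivariant: `ē (d • y) = θ(d) • ē y`. [cite: Brown1982, III §5 (5.6)(b)] -/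
theorem quotientMapOfHom_smul (d : D) (y : D ⧸ N.comap (θ : D →* G)) :
    quotientMapOfHom N θ (d • y) = (θ d : G) • quotientMapOfHom N θ y := by
  induction y using QuotientGroup.induction_on with
  | H a =>
    rw [MulAction.Quotient.smul_coe, quotientMapOfHom_mk, quotientMapOfHom_mk, MulAction.Quotient.smul_coe, smul_eq_mul,
      smul_eq_mul, map_mul]

/-- `ē` is injective. [cite: Brown1982, III §5 (5.6)(b)] -/
theorem quotientMapOfHom_injective : Function.Injective (quotientMapOfHom N θ) := by
  intro y₁ y₂ h
  induction y₁ using QuotientGroup.induction_on with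
  | H a =>
    induction y₂ using QuotientGroup.induction_on with
    | H b =>
      rw [quotientMapOfHom_mk, quotientMapOfHom_mk, QuotientGroup.eq] at h
      rw [QuotientGroup.eq, Subgroup.mem_comap, MonoidHom.coe_coe, map_mul, map_inv]
      exact h

/-- `ē` is surjective as soon as every coset of `N` meets `θ(D)` (`θ(D)·N = G`: ONE double coset). [cite: Brown1982, III §5 (5.6)(b)] -/
theorem quotientMapOfHom_surjective (h : ∀ g : G, ∃ d : D, (θ d)⁻¹ * g ∈ N) : Function.Surjective (quotientMapOfHom N θ) := by
  intro y
  induction y using QuotientGroup.induction_on with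
  | H g =>
    obtain ⟨d, hd⟩ := h g
    exact ⟨(d : D ⧸ N.comap (θ : D →* G)), by rw [quotientMapOfHom_mk]; exact QuotientGroup.eq.mpr hd⟩

/-- **The restricted homomorphism `θ_N : θ⁻¹N →ₜ* N`**, `x ↦ θ x` (for `θ` the restriction `Γ_{K_v} → Γ_K` of an embedding and `N ≤ Γ_K`
this is the tree's `resGalSubgroupOfEmb N ι`). [cite: SerreLocalFields1979, VII §5] -/
def comapSubtypeHom : N.comap (θ : D →* G) →ₜ* N where
  toFun x := ⟨θ (x : D), x.2⟩
  map_one' := Subtype.ext (map_one θ)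
  map_mul' a b := Subtype.ext (map_mul θ (a : D) (b : D))
  continuous_toFun := (θ.continuous_toFun.comp continuous_subtype_val).subtype_mk _

/-- Unfolding `comapSubtypeHom`. [cite: SerreLocalFields1979, VII §5] -/
@[simp]
theorem comapSubtypeHom_apply_coe (x : N.comap (θ : D →* G)) : ((comapSubtypeHom N θ x : N) : G) = θ (x : D) :=
  rfl

/-- `θ⁻¹N` is open when `N` is. [cite: SerreLocalFields1979, VII §5] -/
theorem isOpen_comap (hN : IsOpen (N : Set G)) : IsOpen ((N.comap (θ : D →* G) : Subgroup D) : Set D) :=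
  hN.preimage θ.continuous_toFun

end Cosets

/-! ## §2 The comparison morphism `Φ : Maps(G ⧸ N, X)|_θ ⟶ Maps(D ⧸ θ⁻¹N, X|_θ)` -/

section Phi

variable (X : TopRep.{v} R G) (N : Subgroup G) (θ : D →ₜ* G)

/-- **`Φ : Maps(G ⧸ N, X)|_θ ⟶ Maps(D ⧸ θ⁻¹N, X|_θ)`, `(Φ F)(y') = F(ē y')`** — a morphism of topological `D`-representations
(`ē` is `θ`-equivariant): the component of the trivial double coset of Mackey's decomposition of `θ^* Ind_N^G`.
[cite: Brown1982, III §5 (5.6)(b)] [cite: NeukirchSchmidtWingberg2008, I §5 (1.5.6)–(1.5.7)] -/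
def resCoindFinHom :
    TopRep.res (θ : D →* G) (coindFin X N) ⟶ coindFin (TopRep.res (θ : D →* G) X) (N.comap (θ : D →* G)) :=
  TopRep.ofHom
    { toContinuousLinearMap :=
        { toFun := fun F => fun y' => F (quotientMapOfHom N θ y')
          map_add' := fun _ _ => rfl
          map_smul' := fun _ _ => rfl
          cont := continuous_pi fun y' => continuous_apply _ }
      isIntertwining' := fun d => by
        ext F y'
        change (coindFin X N).ρ (θ d) F (quotientMapOfHom N θ y') = X.ρ (θ d) (F (quotientMapOfHom N θ (d⁻¹ • y')))
        rw [coindFin_ρ_apply, quotientMapOfHom_smul, map_inv] }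

/-- Values of `Φ`: `(Φ F)(y') = F(ē y')`. [cite: Brown1982, III §5 (5.6)(b)] -/
@[simp]
theorem resCoindFinHom_apply (F : coindFin X N) (y' : D ⧸ N.comap (θ : D →* G)) :
    (resCoindFinHom X N θ).hom F y' = F (quotientMapOfHom N θ y') :=
  rfl

/-- **The identity of `X` as a morphism `θ_N^*(X|_N) ⟶ (X|_θ)|_{θ⁻¹N}`** of topological `θ⁻¹N`-representations (both are `X` with `x`
acting by `θ(x)`): the coefficient map of the restriction `H¹(N, X) → H¹(θ⁻¹N, X)` along `θ_N`. [cite: SerreLocalFields1979, VII §5] -/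
def comapCoeffHom :
    TopRep.res (comapSubtypeHom N θ : N.comap (θ : D →* G) →* N) (subgroupRep X N) ⟶
      subgroupRep (TopRep.res (θ : D →* G) X) (N.comap (θ : D →* G)) :=
  TopRep.ofHom ⟨ContinuousLinearMap.id R X, fun _ => rfl⟩

/-- `comapCoeffHom` is the identity on elements. [cite: SerreLocalFields1979, VII §5] -/
@[simp]
theorem comapCoeffHom_apply (x : X) : (comapCoeffHom X N θ).hom x = x := rfl

end Phi

/-! ## §3 Shapiro lifts under `H¹(θ, Φ)`: the trivial double coset -/

section Shapiro

variable (X : TopRep.{v} R G) (N : Subgroup G) (θ : D →ₜ* G)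

/-- **Global representatives ADAPTED to local ones along `ē`**: a system `s'` of representatives of `G ⧸ N` with `s'(1·N) = 1` and
`s'(ē y') = θ(s_D y')` for all `y'` (possible because `ē` is injective). [cite: NeukirchSchmidtWingberg2008, I §5 (1.5.6)] -/
theorem exists_adapted_reps_of_hom {sD : D ⧸ N.comap (θ : D →* G) → D}
    (hsD : ∀ y, (sD y : D ⧸ N.comap (θ : D →* G)) = y) (hsD1 : sD ((1 : D) : D ⧸ N.comap (θ : D →* G)) = 1) :
    ∃ s' : G ⧸ N → G, (∀ y, (s' y : G ⧸ N) = y) ∧ s' ((1 : G) : G ⧸ N) = 1 ∧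
      ∀ y', s' (quotientMapOfHom N θ y') = θ (sD y') := by
  classical
  refine ⟨fun y => if h : ∃ y', quotientMapOfHom N θ y' = y then θ (sD h.choose) else Quotient.out y, fun y => ?_, ?_, fun y' => ?_⟩
  · dsimp only
    by_cases h : ∃ y', quotientMapOfHom N θ y' = y
    · rw [dif_pos h]
      conv_rhs => rw [← h.choose_spec]
      generalize h.choose = z
      induction z using QuotientGroup.induction_on with
      | H a =>
        rw [quotientMapOfHom_mk]
        have ha : (sD (a : D ⧸ N.comap (θ : D →* G)) : D ⧸ N.comap (θ : D →* G)) = a := hsD _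
        have e := congrArg (quotientMapOfHom N θ) ha
        rwa [quotientMapOfHom_mk, quotientMapOfHom_mk] at e
    · rw [dif_neg h]; exact QuotientGroup.out_eq' y
  · dsimp only
    have h : ∃ y', quotientMapOfHom N θ y' = ((1 : G) : G ⧸ N) := ⟨((1 : D) : D ⧸ N.comap (θ : D →* G)), by
      rw [quotientMapOfHom_mk, map_one]⟩
    rw [dif_pos h]
    have hc : h.choose = ((1 : D) : D ⧸ N.comap (θ : D →* G)) :=
      quotientMapOfHom_injective N θ (by rw [h.choose_spec, quotientMapOfHom_mk, map_one])
    rw [hc, hsD1, map_one]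
  · dsimp only
    have h : ∃ y'', quotientMapOfHom N θ y'' = quotientMapOfHom N θ y' := ⟨y', rfl⟩
    rw [dif_pos h, quotientMapOfHom_injective N θ h.choose_spec]

/-- **Shapiro lifts under `H¹(θ, Φ)` — the trivial double coset.** For every class `a ∈ H¹(N, X)`:
`H¹(θ, Φ)(Sh_N^G a) = Sh_{θ⁻¹N}^D(θ_N^* a)`, where `θ_N^* : H¹(N, X) → H¹(θ⁻¹N, X)` is the restriction along `θ_N` (identity on
coefficients) and both Shapiro lifts are the tree's `shapiroLift` for arbitrary representatives with `s(1) = 1`. On cocycles, with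
global representatives adapted to the local ones, the two sides agree ON THE NOSE (same Schreier elements).
[cite: Brown1982, III §5 (5.6)(b)] [cite: NeukirchSchmidtWingberg2008, I §6 Prop. (1.6.4)] -/
theorem map_resCoindFinHom_shapiroLift [IsTopologicalGroup G] [IsTopologicalGroup D] (hN : IsOpen (N : Set G))
    {s : G ⧸ N → G} (hs : ∀ y : G ⧸ N, (s y : G ⧸ N) = y) (hs1 : s ((1 : G) : G ⧸ N) = 1)
    {sD : D ⧸ N.comap (θ : D →* G) → D} (hsD : ∀ y, (sD y : D ⧸ N.comap (θ : D →* G)) = y)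
    (hsD1 : sD ((1 : D) : D ⧸ N.comap (θ : D →* G)) = 1) (a : continuousCohomology 1 (subgroupRep X N)) :
    ContinuousCohomology.map θ (resCoindFinHom X N θ) 1 (shapiroLift X N hN hs hs1 a) =
      shapiroLift (TopRep.res (θ : D →* G) X) (N.comap (θ : D →* G)) (isOpen_comap N θ hN) hsD hsD1
        (ContinuousCohomology.map (comapSubtypeHom N θ) (comapCoeffHom X N θ) 1 a) := by
  obtain ⟨s', hs', hs'1, hadapt⟩ := exists_adapted_reps_of_hom N θ hsD hsD1
  rw [shapiroLift_eq_of_reps X N hN hs hs1 hs' hs'1]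
  obtain ⟨f, rfl⟩ := oneCocycleClass_surjective _ a
  rw [shapiroLift_oneCocycleClass, map_oneCocycleClass, map_oneCocycleClass, shapiroLift_oneCocycleClass]
  congr 1
  refine Subtype.ext (ContinuousMap.ext fun d => funext fun y' => ?_)
  rw [contOneCocycles.pullback_apply, resCoindFinHom_apply, shapiroCocycle_apply, shapiroCocycle_apply,
    contOneCocycles.pullback_apply, comapCoeffHom_apply]
  -- the two Schreier elements agree under `θ`
  have hy : ((θ d : G))⁻¹ • quotientMapOfHom N θ y' = quotientMapOfHom N θ (d⁻¹ • y') := by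
    rw [quotientMapOfHom_smul, map_inv]
  have hsch : schreierElt N hs' (θ d) (((θ d : G))⁻¹ • quotientMapOfHom N θ y') =
      comapSubtypeHom N θ (schreierElt (N.comap (θ : D →* G)) hsD d (d⁻¹ • y')) := by
    apply Subtype.ext
    rw [schreierElt_coe, comapSubtypeHom_apply_coe, schreierElt_coe, hy, smul_inv_smul, ← quotientMapOfHom_smul, smul_inv_smul,
      hadapt, hadapt, map_mul, map_mul, map_inv]
  rw [hsch, hadapt]
  rfl

end Shapiro

/-! ## §4 The summed pairings when `θ(D)·N = G`, and the cup products -/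

section Pairing

variable {X Y Z : TopRep.{v} R G} (P : ContPairing X Y Z) (N : Subgroup G) (θ : D →ₜ* G)
  [Fintype (G ⧸ N)] [Fintype (D ⧸ N.comap (θ : D →* G))]

/-- **Summed pairings correspond under `Φ × Φ` when `ē` is a bijection**: `Σ_{y' ∈ D/θ⁻¹N} P(F(ē y'), F'(ē y')) = Σ_{y ∈ G/N} P(F y, F' y)`.
[cite: NeukirchSchmidtWingberg2008, I §5 Prop. (1.5.3)(iv)] -/
theorem coindFin_toLin_resCoindFinHom (hsurj : Function.Surjective (quotientMapOfHom N θ)) (F : coindFin X N) (F' : coindFin Y N) :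
    ((P.restrict θ).coindFin (N.comap (θ : D →* G))).toLin ((resCoindFinHom X N θ).hom F) ((resCoindFinHom Y N θ).hom F') =
      (P.coindFin N).toLin F F' := by
  rw [ContPairing.coindFin_toLin_apply, ContPairing.coindFin_toLin_apply]
  exact Equiv.sum_comp (Equiv.ofBijective _ ⟨quotientMapOfHom_injective N θ, hsurj⟩) (fun y => P.toLin (F y) (F' y))

/-- **Cup products of Shapiro lifts under restriction along `θ`, one double coset.** If `θ(D)·N = G` then for `a ∈ H¹(N, X)`,
`b ∈ H¹(N, Y)` and every continuous equivariant pairing `P : X × Y → Z`: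
`θ^*(Sh_N^G a ∪_{Σ P} Sh_N^G b) = Sh_{θ⁻¹N}^D(θ_N^* a) ∪_{Σ P|_θ} Sh_{θ⁻¹N}^D(θ_N^* b)` in `H²(D, Z|_θ)`. In the application (`θ =`
`Γ_{ℚ₂} → Γ_ℚ`, `N = Gal(ℚ̄/ℚ_n)`, `P` = Weil pairing on `E[2^K]`) the right side is the LOCAL layer pairing of the (D-layer) construction.
[cite: Brown1982, III §5 (5.6)(b)] [cite: NeukirchSchmidtWingberg2008, I §5 Prop. 1.5.3 and I §6 Prop. (1.6.4)] -/
theorem map_cupProduct_coindFin_shapiroLift [IsTopologicalGroup G] [IsTopologicalGroup D] [LocallyCompactSpace G]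
    [LocallyCompactSpace D] (hN : IsOpen (N : Set G)) (hsurj : Function.Surjective (quotientMapOfHom N θ))
    {s : G ⧸ N → G} (hs : ∀ y : G ⧸ N, (s y : G ⧸ N) = y) (hs1 : s ((1 : G) : G ⧸ N) = 1)
    {sD : D ⧸ N.comap (θ : D →* G) → D} (hsD : ∀ y, (sD y : D ⧸ N.comap (θ : D →* G)) = y)
    (hsD1 : sD ((1 : D) : D ⧸ N.comap (θ : D →* G)) = 1)
    (a : continuousCohomology 1 (subgroupRep X N)) (b : continuousCohomology 1 (subgroupRep Y N)) :
    ContinuousCohomology.map θ (𝟙 (TopRep.res (θ : D →* G) Z)) 2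
        ((P.coindFin N).cupProduct (shapiroLift X N hN hs hs1 a) (shapiroLift Y N hN hs hs1 b)) =
      ((P.restrict θ).coindFin (N.comap (θ : D →* G))).cupProduct
        (shapiroLift (TopRep.res (θ : D →* G) X) (N.comap (θ : D →* G)) (isOpen_comap N θ hN) hsD hsD1
          (ContinuousCohomology.map (comapSubtypeHom N θ) (comapCoeffHom X N θ) 1 a))
        (shapiroLift (TopRep.res (θ : D →* G) Y) (N.comap (θ : D →* G)) (isOpen_comap N θ hN) hsD hsD1
          (ContinuousCohomology.map (comapSubtypeHom N θ) (comapCoeffHom Y N θ) 1 b)) := by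
  rw [← map_resCoindFinHom_shapiroLift X N θ hN hs hs1 hsD hsD1 a, ← map_resCoindFinHom_shapiroLift Y N θ hN hs hs1 hsD hsD1 b]
  exact ContPairing.cupProduct_mapPair (P.coindFin N) ((P.restrict θ).coindFin (N.comap (θ : D →* G))) θ
    (resCoindFinHom X N θ) (resCoindFinHom Y N θ) (𝟙 _)
    (fun F F' => (coindFin_toLin_resCoindFinHom P N θ hsurj F F').symm) _ _

end Pairing

end Literature.NumberTheory.GaloisRepresentations

end
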